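import Summits.QuantumFields.BalabanUV.Beta.FP.MixLoopInstanceBlockFamilyField
import Summits.QuantumFields.BalabanUV.Beta.FP.MixLoopPowerCountingMassGamma

/-!
# `Beta/FP/MixLoopInstanceBlockFamilyGamma` — road «FP» (binder row D1), row **RHOA-6e (INST-MIX1)** «THE MIX-1 ENGINE AT THE ROOTED BLOCK FAMILY AND THE
# LATTICE COLUMNS»: RHOA-6c′'s mass-currency (MIX-1) engine `MixLoopPowerCountingMassGamma.coarse_mix1_secondMoment_le` (`tr(G_C·Q̇Γ₀Q̇ᵀ)`) INSTANTIATED with the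
# first-jet majorant kernel `ker₁ (blkW N p) (blkFld N μ u) (blkBg N μ u rad id)` of RHOA-6b′'s rooted block families, the insertion-side letter (M) of
# `MixLoopInstanceBlockFamily.windowedMass_blk_le`, the FIELD-side letter (M̃Γ) of `MixLoopInstanceBlockFamilyField.windowedFieldMass_blk_le`, and the running∕reference
# legs pinned to the perfect lattice columns `N⁴ • colOf (KPerf …)`; the coarse covariance `G` and the fine profile `Γ` stay ABSTRACT under their displayed letters
# (their instances at the perfect data are IR-2's ∕ the owner's LEDGER) — every power of `N = Lc^m` DISPLAYED ([folklore] index plumbing on `ℤ⁴`; no road object identified)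

HONEST FRAMING (cell `pub-balaban`, β sub-cell, verbatim): discharging `BetaPertH` makes Bałaban's UV stability UNCONDITIONAL — a real constructive-QFT
result; it is NOT the continuum limit and NOT the Clay problem.  THIS MODULE is [folklore] finite-sum plumbing composed BY NAME with ACCEPTED road theorems:
`MixLoopPowerCountingMassGamma.coarse_mix1_secondMoment_le` (t4-ne7b-formalise-leaf-01-g23, RHOA-6c′), `MixLoopInstanceBlockFamily.{blk_ker₁_fld_local, windowedMass_blk_le,
latticeColumn_engineLetters}` (p247290) and `MixLoopInstanceBlockFamilyField.windowedFieldMass_blk_le`.  It asserts nothing about Bałaban's objects, cites nothing, mints no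
`Prop` fact, has no `def`, 0 sorry.  NOT `Mix_n = O(1)` (the instance number `Σ_σ p σ ≲ N` is KER-γ (γ)'s; `C_G`, `C_Γ` in lattice units are IR-2's; the four-direction
sum and the (rem)-piece packaging for `RemainderLedger.hbook_perfect_of_pieces` are the owner's LEDGER), NOT hbook, NOT D1, NOT BetaPertH, NOT continuum, NOT Clay.
HONEST DEPENDENCY: continuum YM on T⁴ ⇐ BetaPertH ∧ nine spine estimates (0/9 proved); BetaPertH ⇐ (D1) ∧ (D4) ∧ CAP+tail; G-an2-4 gates asym, D1 and NE2/3/4.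

ABSOLUTE RULE (cell charter, verbatim): «No internally-minted statement may enter as a cited fact. Every hypothesis is either kernel-proved in this package or a
verbatim quotation of a PUBLISHED theorem with page reference. The manuscript(s) under audit are NOT citable for their own disputed steps — they are the thing under
adjudication; programme-internal (2001/route/tribunal) claims are never citable.»

CURRENCY: as in `MixLoopInstanceBlockFamily` (labels = points, `strB = id`; `rad`, `p`, `ℓ₀`, `R₀ ≥ 2` FREE with their displayed letters).  The (MIX-1) engine carries NO
coarse-radius letter (U), only the offset letter (W): so the coarse windows `U b` are ARBITRARY finite sets as given, and the offset window `W` is freed by the support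
(`blk_ker₁_fld_local`: far offsets contribute vanishing jet entries).
CONTENT.  §1 `loopKernel₁_eq_filter` (far offsets vanish in the (MIX-1) kernel shape) and **`coarse_mix1_secondMoment_blk_free`** = the engine BY NAME at
`qd := ker₁ (blkW N p) (blkFld N μ u) (blkBg N μ u rad id)`, radius multiplier `R := R₀ + 2`, (M) := `windowedMass_blk_le` (centre `N•v₀`), (M̃Γ) := `windowedFieldMass_blk_le`,
for ARBITRARY `U : Pt → Finset Pt` and finite `W`, legs `J` abstract under (J)(J′), `G`∕`Γ` abstract under (G₀)(Γ): bound
`3·C_J·C_J′·(1+16∕δ²)·(C_G·(C_Γ·(3+8(R₀+2)²))·Ã·A_M)`, `Ã = ((ℓ₀+N)·(N⁻⁴·Σp))·(P(δ)·N²)`, `A_M = ((ℓ₀+N)·Σp)·e^{δR₀∕2}·(e^{δ∕2}(1+480e^{δ∕4}(4∕δ)⁴))`.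
§2 `latticeColumn_letterJ_of_le` (the columns' (J) letter at any rate `δ ≤ κ₀∕4`) and the END **`mix1_rem_blockFamily`**: `J := N⁴ • colOf (KPerf Lc (sfStep Lc) (smStep 3 Lc) m)`
(`C_J = C·N⁻¹`, `C_J′ = C·N⁻¹·A(κ₀)`, ONE `(κ₀, C)` ∀ m ≥ 1), the profile rate `δ` of `Γ` FREE in `(0, κ₀∕4]` (so the LEDGER may take `δ := min(κ₀∕4, δ_Γ)`):
`≤ 3·(C·N⁻¹)·(C·N⁻¹·A(κ₀))·(1+16∕δ²)·(C_G·(C_Γ·(3+8(R₀+2)²))·Ã·A_M)` = `N⁻⁴·((ℓ₀+N)·Σp)²·C_G·C_Γ` × m-free numbers — the SAME instance number `Σp ≲ N` as (MIX-2)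
(`MixLoopInstanceBlockFamily.mix2_rem_blockFamily`), modulo the units of `C_G·C_Γ`.  `∃ κ₀ C` BEFORE `∀ δ`, `∀ m` and the block data.
NOT TYPED HERE: the identification with the road's (MIX-1) term (KER-γ (α)), `G = G_C`, `Γ = Γ₀` at the perfect data (IR-2), MIX-3∕4, the (rem) packaging.
Provenance: cross-cell idle-seat kernel duty NE7b → β∕D1, unit `b2b-balaban-t4-ne7b-formalise-leaf-02` gen 23 (prover-…-leaf-02-g23-0), 2026-08-21, INTENT O-ne7bleaf02g23-1
(journal l.26874) under R-FP-33 (c); «not in print; our bookkeeping»; no existing file touched.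
-/

noncomputable section

namespace Summit.QuantumFields.BalabanUV.Beta.FP.MixLoopInstanceBlockFamilyGamma

open Finset Real
open scoped BigOperators
open Literature.MathematicalPhysics.QuantumFieldTheory.Balaban1983to89
open Literature.MathematicalPhysics.QuantumFieldTheory.Balaban1983to89.Beta
open DyadicShell (Pt supNorm)
open AxialBlockWeights (idx)
open Summit.QuantumFields.BalabanUV.Beta.GAN24.CombesThomas (sfStep smStep)
open Summit.QuantumFields.BalabanUV.Beta.FP.PerfectObjectsT (KPerf)
open Summit.QuantumFields.BalabanUV.Beta.FP.TransportInfinityM (colOf)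
open Summit.QuantumFields.BalabanUV.Beta.FP.AveragingJetLettersRooted (ker₁ blkW blkFld blkBg)
open Summit.QuantumFields.BalabanUV.Beta.FP.MixLoopPowerCounting (supNorm_cast_nonneg)
open Summit.QuantumFields.BalabanUV.Beta.FP.MixLoopPowerCountingMassGamma (coarse_mix1_secondMoment_le)
open Summit.QuantumFields.BalabanUV.Beta.FP.MixLoopInstanceBlockFamily (blk_ker₁_fld_local windowedMass_blk_le latticeColumn_engineLetters)
open Summit.QuantumFields.BalabanUV.Beta.FP.MixLoopInstanceBlockFamilyField (windowedFieldMass_blk_le)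

/-! ## §1 Free offset window and the engine at the block family, abstract legs -/

/-- [folklore] **FAR OFFSETS VANISH IN THE (MIX-1) KERNEL**: if the jet kernel `q u b (b + w)` vanishes unless `PW w`, then for all coarse windows and every finite `W`
`Σ_{u∈U b}Σ_{u′∈U b′} G u′ u·Σ_{w,w′∈W} q u b (b+w)·Γ(b+w,b′+w′)·q u′ b′ (b′+w′)` equals the same sum over `W.filter PW` (`Finset.sum_filter_of_ne`). -/
theorem loopKernel₁_eq_filter {q : Pt → Pt → Pt → ℝ} (G Γ : Pt → Pt → ℝ) (PW : Pt → Prop) [DecidablePred PW]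
    (hzW : ∀ u b w, ¬ PW w → q u b (b + w) = 0) (U : Pt → Finset Pt) (W : Finset Pt) (b b' : Pt) :
    (∑ u ∈ U b, ∑ u' ∈ U b', G u' u * ∑ w ∈ W, ∑ w' ∈ W, q u b (b + w) * Γ (b + w) (b' + w') * q u' b' (b' + w'))
      = ∑ u ∈ U b, ∑ u' ∈ U b', G u' u *
          ∑ w ∈ W.filter PW, ∑ w' ∈ W.filter PW, q u b (b + w) * Γ (b + w) (b' + w') * q u' b' (b' + w') := by
  refine Finset.sum_congr rfl fun u _ => Finset.sum_congr rfl fun u' _ => ?_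
  congr 1
  symm
  rw [Finset.sum_filter_of_ne]
  · refine Finset.sum_congr rfl fun w _ => ?_
    rw [Finset.sum_filter_of_ne]
    intro w' _ hne
    by_contra hfar
    exact hne (by rw [hzW u' b' w' hfar, mul_zero])
  · intro w _ hne
    by_contra hfar
    exact hne (Finset.sum_eq_zero fun w' _ => by rw [hzW u b w hfar, zero_mul, zero_mul])

section Block

variable {σ : Type*} [Fintype σ] {N : ℕ} {μ : Fin 4} {p : σ → ℝ} {rad : σ → Pt → Pt → List Pt} {ℓ₀ R₀ : ℕ}

/-- **THE (MIX-1) ENGINE AT THE ROOTED BLOCK FAMILY, FREE OFFSET WINDOW, ABSTRACT LEGS** ([folklore] plumbing; `coarse_mix1_secondMoment_le` BY NAME at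
`qd u b c := ker₁ (blkW N p) (blkFld N μ u) (blkBg N μ u rad id) b c`, radius multiplier `R := R₀ + 2`, (M) := `windowedMass_blk_le` at the centre `N•v₀`,
(M̃Γ) := `windowedFieldMass_blk_le`): for ARBITRARY coarse windows `U b` and EVERY finite offset window `W` (far offsets vanish, `blk_ker₁_fld_local`), under
(G₀) `|G u u′| ≤ C_G`, (Γ) `|Γ c c′| ≤ C_Γ(‖c−c′‖∞+1)⁻²e^{−(δ∕N)‖c−c′‖∞}`, (J) `|J b v₀| ≤ C_J e^{−(δ∕N)‖b−N•v₀‖∞}`, (J′) `Σ_{v∈V}(1+(‖b′−N•v‖∞∕N)²)|J b′ v| ≤ C_J′`: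
`Σ_{v∈V}‖v−v₀‖∞²·|Σ_{b,b′∈S} J b v₀·J b′ v·k₁(b,b′)| ≤ 3·C_J·C_J′·(1+16∕δ²)·(C_G·(C_Γ·(3+8(R₀+2)²))·Ã·A_M)`,
`Ã = ((ℓ₀+N)·(N⁻⁴·Σp))·(P(δ)·N²)`, `P(δ) = (1+80e^{δ∕4}(4∕δ)²) + (1+480e^{δ∕4}(4∕δ)⁴)`, `A_M = ((ℓ₀+N)·Σp)·e^{δR₀∕2}·(e^{δ∕2}(1+480e^{δ∕4}(4∕δ)⁴))`. -/
theorem coarse_mix1_secondMoment_blk_free {δ : ℝ} (hδ : 0 < δ) (hN : 1 ≤ N) (μ : Fin 4) (hp : ∀ s, 0 ≤ p s)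
    (hrad : ∀ s u x', (rad s u x').length ≤ ℓ₀) (hR₀ : 2 ≤ R₀)
    (hradR : ∀ (s : σ) (u : Pt) (q : ↥(idx N)) (ℓ : Pt), ℓ ∈ rad s u q.1.1 → supNorm (ℓ - (N : ℤ) • u) ≤ R₀ * N)
    (U : Pt → Finset Pt) (W : Finset Pt) {G Γ J : Pt → Pt → ℝ} {C_G C_Γ C_J C_J' : ℝ}
    (hG : ∀ u u', |G u u'| ≤ C_G)
    (hΓ : ∀ c c', |Γ c c'| ≤ C_Γ / ((supNorm (c - c') : ℝ) + 1) ^ 2 * Real.exp (-(δ / N) * (supNorm (c - c') : ℝ)))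
    (S V : Finset Pt) (v₀ : Pt)
    (hJ : ∀ b, |J b v₀| ≤ C_J * Real.exp (-(δ / N) * (supNorm (b - (N : ℤ) • v₀) : ℝ)))
    (hJ' : ∀ b', ∑ v ∈ V, (1 + ((supNorm (b' - (N : ℤ) • v) : ℝ) / N) ^ 2) * |J b' v| ≤ C_J') :
    ∑ v ∈ V, (supNorm (v - v₀) : ℝ) ^ 2 *
        |∑ b ∈ S, ∑ b' ∈ S, J b v₀ * J b' v *
          (∑ u ∈ U b, ∑ u' ∈ U b', G u' u * ∑ w ∈ W, ∑ w' ∈ W,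
            ker₁ (blkW N p) (blkFld N μ u) (blkBg N μ u rad id) b (b + w) * Γ (b + w) (b' + w') *
              ker₁ (blkW N p) (blkFld N μ u') (blkBg N μ u' rad id) b' (b' + w'))|
      ≤ 3 * C_J * C_J' * (1 + 16 / δ ^ 2) *
          (C_G * (C_Γ * (3 + 8 * ((R₀ : ℝ) + 2) ^ 2)) *
            ((((ℓ₀ + N : ℕ) : ℝ) * (((N : ℝ) ^ 4)⁻¹ * ∑ s, p s)) *
              (((1 + 80 * Real.exp (δ / 4) * (4 / δ) ^ 2) + (1 + 480 * Real.exp (δ / 4) * (4 / δ) ^ 4)) * (N : ℝ) ^ 2)) *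
            ((((ℓ₀ + N : ℕ) : ℝ) * ∑ s, p s) * Real.exp (δ * R₀ / 2) *
              (Real.exp (δ / 2) * (1 + 480 * Real.exp (δ / 4) * (4 / δ) ^ 4)))) := by
  classical
  have hzW : ∀ u b w, ¬ supNorm w ≤ (R₀ + 2) * N →
      ker₁ (blkW N p) (blkFld N μ u) (blkBg N μ u rad id) b (b + w) = 0 := by
    intro u b w hfar
    by_contra hne
    have h := blk_ker₁_fld_local hR₀ hradR hne
    rw [add_sub_cancel_left] at h
    exact hfar h
  have hWr : ∀ w ∈ W.filter (fun w => supNorm w ≤ (R₀ + 2) * N), supNorm w ≤ (R₀ + 2) * N :=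
    fun w hw => (Finset.mem_filter.mp hw).2
  have hA := coarse_mix1_secondMoment_le
    (qd := fun u b c => ker₁ (blkW N p) (blkFld N μ u) (blkBg N μ u rad id) b c) (R := R₀ + 2) (U := U)
    hδ hN hWr hG hΓ S V v₀ hJ hJ'
    (fun c => windowedFieldMass_blk_le hδ hN μ hp hrad U (W.filter (fun w => supNorm w ≤ (R₀ + 2) * N)) S c)
    (windowedMass_blk_le hδ hN μ hp hrad hR₀ hradR U (W.filter (fun w => supNorm w ≤ (R₀ + 2) * N)) S ((N : ℤ) • v₀))
  have e : (((R₀ + 2 : ℕ) : ℝ)) = (R₀ : ℝ) + 2 := by push_cast; ring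
  rw [e] at hA
  have hker := fun b b' => loopKernel₁_eq_filter (q := fun u b c => ker₁ (blkW N p) (blkFld N μ u) (blkBg N μ u rad id) b c) G Γ
    (fun w => supNorm w ≤ (R₀ + 2) * N) hzW U W b b'
  simp only [hker]
  exact hA

end Block

/-! ## §2 The lattice columns at a weaker rate and the END -/

section Columns

variable {Lc : ℕ} [NeZero Lc]

/-- [our object] **THE COLUMNS' (J) LETTER AT ANY RATE `δ ≤ κ₀∕4`** (rate weakening of `latticeColumn_engineLetters` (I)∕(J): `e^{−((κ₀∕4)∕N)x} ≤ e^{−(δ∕N)x}` for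
`x ≥ 0`), together with the rate-free (J′) letter: ONE `(κ₀, C)` for all `m ≥ 1`, all `κ l`, all `δ ∈ (0, κ₀∕4]`. -/
theorem latticeColumn_letterJ_of_le (hLc : 2 ≤ Lc) :
    ∃ κ₀ C : ℝ, 0 < κ₀ ∧ 0 ≤ C ∧ ∀ δ : ℝ, δ ≤ κ₀ / 4 → ∀ m : ℕ, 1 ≤ m → ∀ κ l : Fin 4,
      (∀ c u : Pt,
        |((((Lc ^ m : ℕ) : ℝ) ^ 4) • colOf (KPerf (d := 3) Lc (sfStep Lc) (smStep 3 Lc) m)) κ l (((Lc ^ m : ℕ) : ℤ) • u - c)|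
          ≤ C * (((Lc ^ m : ℕ) : ℝ))⁻¹ * Real.exp (-(δ / ((Lc ^ m : ℕ) : ℝ)) * (supNorm (c - ((Lc ^ m : ℕ) : ℤ) • u) : ℝ))) ∧
      (∀ (b : Pt) (V : Finset Pt),
        ∑ v ∈ V, (1 + ((supNorm (b - ((Lc ^ m : ℕ) : ℤ) • v) : ℝ) / ((Lc ^ m : ℕ) : ℝ)) ^ 2)
            * |((((Lc ^ m : ℕ) : ℝ) ^ 4) • colOf (KPerf (d := 3) Lc (sfStep Lc) (smStep 3 Lc) m)) κ l (((Lc ^ m : ℕ) : ℤ) • v - b)|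
          ≤ C * (((Lc ^ m : ℕ) : ℝ))⁻¹ * ((1 + 16 / (κ₀ / 4) ^ 2)
              * (Real.exp (κ₀ / 4 / 2) * (1 + 480 * Real.exp (κ₀ / 4 / 2 / 2) * (2 / (κ₀ / 4 / 2)) ^ 4)))) := by
  obtain ⟨κ₀, C, hκ₀, hC, h⟩ := latticeColumn_engineLetters (Lc := Lc) hLc
  refine ⟨κ₀, C, hκ₀, hC, fun δ hδ m hm κ l => ⟨fun c u => ?_, (h m hm κ l).2⟩⟩
  have hN : (0 : ℝ) < ((Lc ^ m : ℕ) : ℝ) := by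
    have : 0 < Lc := lt_of_lt_of_le (by norm_num) hLc
    exact_mod_cast pow_pos this m
  refine ((h m hm κ l).1 c u).trans (mul_le_mul_of_nonneg_left (Real.exp_le_exp.mpr ?_) (by positivity))
  have hx := supNorm_cast_nonneg (c - ((Lc ^ m : ℕ) : ℤ) • u)
  have hrate : δ / ((Lc ^ m : ℕ) : ℝ) ≤ κ₀ / 4 / ((Lc ^ m : ℕ) : ℝ) := div_le_div_of_nonneg_right hδ hN.le
  nlinarith

/-- **THE END `mix1_rem_blockFamily` — ROW RHOA-6e (INST-MIX1)** ([our object]; `d = 3`, `2 ≤ Lc`): there are `κ₀ > 0` and `C ≥ 0` (the perfect columns' letters) such that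
for EVERY profile rate `δ ∈ (0, κ₀∕4]` and EVERY `m ≥ 1`, with `N = Lc^m` and `J_m = N⁴ • colOf (KPerf Lc (sfStep Lc) (smStep 3 Lc) m)`, for every coarse direction `μ`, leg
index pair `(κJ, lJ)`, every rooted block family at blocking `N` (rules `σ`, probabilities `p σ ≥ 0`, radial words of length `≤ ℓ₀` within `R₀·N` of the anchor, `2 ≤ R₀`),
ARBITRARY coarse windows `U b`, every finite offset window `W`, every coarse covariance `G` with (G₀) `|G u u′| ≤ C_G` and fine profile `Γ` with
(Γ) `|Γ c c′| ≤ C_Γ(‖c−c′‖∞+1)⁻²e^{−(δ∕N)‖c−c′‖∞}`, all finite `S`, `V` and every `v₀`: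
`Σ_{v∈V}‖v−v₀‖∞²·|Σ_{b,b′∈S} J_m κJ lJ (N•v₀−b)·J_m κJ lJ (N•v−b′)·Σ_{u∈U b,u′∈U b′} G u′ u·Σ_{w,w′∈W} ker₁^{(u)} b (b+w)·Γ(b+w,b′+w′)·ker₁^{(u′)} b′ (b′+w′)|`
`≤ 3·(C·N⁻¹)·(C·N⁻¹·A(κ₀))·(1+16∕δ²)·(C_G·(C_Γ·(3+8(R₀+2)²))·(((ℓ₀+N)·(N⁻⁴·Σp))·(P(δ)·N²))·(((ℓ₀+N)·Σp)·e^{δR₀∕2}·(e^{δ∕2}(1+480e^{δ∕4}(4∕δ)⁴))))`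
— EVERY power of `N` displayed: `N⁻⁴·((ℓ₀+N)·Σp)²·C_G·C_Γ` × m-free numbers.  NOT the identification with the road's (MIX-1) term, NOT `G = G_C`∕`Γ = Γ₀` (IR-2),
NOT the four-direction sum, NOT `Mix_n = O(1)`, NOT hbook, NOT D1, NOT BetaPertH. -/
theorem mix1_rem_blockFamily (hLc : 2 ≤ Lc) :
    ∃ κ₀ C : ℝ, 0 < κ₀ ∧ 0 ≤ C ∧ ∀ δ : ℝ, 0 < δ → δ ≤ κ₀ / 4 → ∀ m : ℕ, 1 ≤ m →
      ∀ {σ : Type*} [Fintype σ] (μ κJ lJ : Fin 4) {p : σ → ℝ} (_ : ∀ s, 0 ≤ p s)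
        {rad : σ → Pt → Pt → List Pt} {ℓ₀ R₀ : ℕ} (_ : ∀ s u x', (rad s u x').length ≤ ℓ₀) (_ : 2 ≤ R₀)
        (_ : ∀ (s : σ) (u : Pt) (q : ↥(idx (Lc ^ m))) (ℓ : Pt), ℓ ∈ rad s u q.1.1 →
          supNorm (ℓ - ((Lc ^ m : ℕ) : ℤ) • u) ≤ R₀ * Lc ^ m)
        (U : Pt → Finset Pt) (W : Finset Pt) {G Γ : Pt → Pt → ℝ} {C_G C_Γ : ℝ} (_ : ∀ u u', |G u u'| ≤ C_G)
        (_ : ∀ c c', |Γ c c'| ≤ C_Γ / ((supNorm (c - c') : ℝ) + 1) ^ 2 *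
          Real.exp (-(δ / ((Lc ^ m : ℕ) : ℝ)) * (supNorm (c - c') : ℝ)))
        (S V : Finset Pt) (v₀ : Pt),
        ∑ v ∈ V, (supNorm (v - v₀) : ℝ) ^ 2 *
            |∑ b ∈ S, ∑ b' ∈ S,
              ((((Lc ^ m : ℕ) : ℝ) ^ 4) • colOf (KPerf (d := 3) Lc (sfStep Lc) (smStep 3 Lc) m)) κJ lJ (((Lc ^ m : ℕ) : ℤ) • v₀ - b) *
              ((((Lc ^ m : ℕ) : ℝ) ^ 4) • colOf (KPerf (d := 3) Lc (sfStep Lc) (smStep 3 Lc) m)) κJ lJ (((Lc ^ m : ℕ) : ℤ) • v - b') *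
              (∑ u ∈ U b, ∑ u' ∈ U b', G u' u * ∑ w ∈ W, ∑ w' ∈ W,
                ker₁ (blkW (Lc ^ m) p) (blkFld (Lc ^ m) μ u) (blkBg (Lc ^ m) μ u rad id) b (b + w) * Γ (b + w) (b' + w') *
                  ker₁ (blkW (Lc ^ m) p) (blkFld (Lc ^ m) μ u') (blkBg (Lc ^ m) μ u' rad id) b' (b' + w'))|
          ≤ 3 * (C * (((Lc ^ m : ℕ) : ℝ))⁻¹)
              * (C * (((Lc ^ m : ℕ) : ℝ))⁻¹ * ((1 + 16 / (κ₀ / 4) ^ 2)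
                  * (Real.exp (κ₀ / 4 / 2) * (1 + 480 * Real.exp (κ₀ / 4 / 2 / 2) * (2 / (κ₀ / 4 / 2)) ^ 4))))
              * (1 + 16 / δ ^ 2) *
            (C_G * (C_Γ * (3 + 8 * ((R₀ : ℝ) + 2) ^ 2)) *
              ((((ℓ₀ + Lc ^ m : ℕ) : ℝ) * ((((Lc ^ m : ℕ) : ℝ) ^ 4)⁻¹ * ∑ s, p s)) *
                (((1 + 80 * Real.exp (δ / 4) * (4 / δ) ^ 2) + (1 + 480 * Real.exp (δ / 4) * (4 / δ) ^ 4)) * ((Lc ^ m : ℕ) : ℝ) ^ 2)) *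
              ((((ℓ₀ + Lc ^ m : ℕ) : ℝ) * ∑ s, p s) * Real.exp (δ * R₀ / 2) *
                (Real.exp (δ / 2) * (1 + 480 * Real.exp (δ / 4) * (4 / δ) ^ 4)))) := by
  obtain ⟨κ₀, C, hκ₀, hC, h⟩ := latticeColumn_letterJ_of_le (Lc := Lc) hLc
  refine ⟨κ₀, C, hκ₀, hC, fun δ hδ hδκ m hm σ _ μ κJ lJ p hp rad ℓ₀ R₀ hrad hR₀ hradR U W G Γ C_G C_Γ hG hΓ S V v₀ => ?_⟩
  have hN1 : 1 ≤ Lc ^ m := Nat.one_le_pow m Lc (le_trans (by norm_num) hLc)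
  exact coarse_mix1_secondMoment_blk_free (N := Lc ^ m) hδ hN1 μ hp hrad hR₀ hradR U W hG hΓ S V v₀
    (J := fun b v => ((((Lc ^ m : ℕ) : ℝ) ^ 4) • colOf (KPerf (d := 3) Lc (sfStep Lc) (smStep 3 Lc) m)) κJ lJ
      (((Lc ^ m : ℕ) : ℤ) • v - b))
    (fun b => (h δ hδκ m hm κJ lJ).1 b v₀) (fun b' => (h δ hδκ m hm κJ lJ).2 b' V)

end Columns

end Summit.QuantumFields.BalabanUV.Beta.FP.MixLoopInstanceBlockFamilyGamma

end
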